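import Summits.BirchSwinnertonDyer.BirchSwinnertonDyer.Theorems.TwoAdicConverseBDPSplitPrimeIdelicCharacters
import Literature.NumberTheory.Automorphic.IdeleIdealClass
import HarnessLib

/-!
# `[M_v(K) : K_∞] < ∞`: the restrictions to `Gal(K̄/K_∞)` of the finite-order characters of `Γ_K` unramified outside the
# split prime `v` form a FINITE set (crux O2 `BDPSelmerLowerDivisibilityAtTwo`, stmt-BirchSwinnertonDyer-24728; the
# class-field-theoretic heart of the kernel discharge of `Greenberg1978.splitPrime_iwasawaModule_finite_torsion`)

Cell `bsd-2adic`, seat `bsd-2adic-conv-1` GEN 41; helper `--supports stmt-BirchSwinnertonDyer-24728`. THEOREMS ONLY (no definition,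
no named fact, no instance, no `sorry`); sequel to `…SplitPrimeIdelicCharacters`. HONEST FRAMING: class field theory of an
imaginary quadratic field only; nothing about any curve is asserted; BSD is proved for no curve; O2 / 19556 / 19218 OPEN.

## What (`K` imaginary quadratic, `p = v v̄` split — ANY prime `p` —, `κ` the `ℤ_p`-extension unramified outside `v`)

* §5 `finite_setOf_idelicCharacter_localUnits_eq_one` — `F_v = {u ∈ 𝒪_vˣ : Λ_κ(⟨u⟩_v) = 1}` is finite (rank one at `v`,
  non-vanishing `ZpExtension.exists_idelicCharacter_localUnits_ne_one`); **`exists_finset_reduction`** — a finite `E ⊆ ker Λ_κ`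
  and `N ≥ 1` such that every idele character `Ψ` killing `Kˣ`, `K_∞ˣ` and the local units at all `w ≠ v` satisfies
  `Ψ(e)^N = 1` on `E` and `Ψ(x) ∈ Ψ(E)` for `x ∈ ker Λ_κ` (class-group reduction
  `FiniteAdeleRing.exists_finset_forall_exists_unitOrd_eq_zero` + `x^{h_K} ∈ Kˣ 𝕌_K`).
* §6 **`finite_setOf_restrict_kerSubgroup`** — for a DISCRETE abelian `B` with finite `N`-torsion: the restrictions to
  `Gal(K̄/K_∞)` of the continuous `χ : Γ_K → B` killing `I_w` for all `w ≠ v` form a finite set (`[·, K]` onto: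
  `χ ↦ Λ_χ|_{ker Λ_κ}` is faithful on restrictions, and takes finitely many values by §5). This is «`Gal(M_v(K)/K_∞)` finite»
  for the maximal abelian extension `M_v(K)` unramified outside `v` — Lang's `Gal(M/K) ∼ U_p/Ē` cut down by `𝒪_{v̄}ˣ`.

References: [Lang1990] Ch. 5 §5 Thm. 5.1–5.2; [Washington1997] §13.1; [CasselsFrohlichANT1967] II §17, VII §4;
[Greenberg1978] §4; [NeukirchANT1999] VI §1.
-/

-- D-0017: single-problem summit, the namespace repeats the problem name by design.
set_option linter.dupNamespace false
set_option autoImplicit false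

noncomputable section

open scoped Classical

open NumberField IsDedekindDomain Field
open Literature.NumberTheory.GaloisRepresentations Literature.NumberTheory.NumberFields
  Literature.NumberTheory.EllipticCurves

namespace Summit.BirchSwinnertonDyer.BirchSwinnertonDyer.Theorems.TwoAdicBDPSplitPrimeTorsion

variable {K : Type} [Field K] [NumberField K]

/-! ## §5 The count: restrictions to `ker Λ_κ` of admissible idele characters form a finite set -/

section Count

variable {p : ℕ} [Fact p.Prime]

/-- **`F_v := {u ∈ 𝒪_vˣ : Λ_κ(⟨u⟩_v) = 1}` is FINITE** for the idelic character `Λ_κ` of the `ℤ_p`-line of an imaginary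
quadratic `K` unramified outside the split place `v`: `Λ_κ` is non-trivial on `𝒪_vˣ` (it kills `𝒪_{v̄}ˣ` by unramifiedness
and cannot kill all local units above `p`, `ZpExtension.exists_idelicCharacter_localUnits_ne_one`), and `𝒪_vˣ` has
`ℤ_p`-rank one (`finite_setOf_apply_eq_one_of_natCard_quot_eq`). [cite: Lang1990, Ch. 5 §5, Thm. 5.1]
[cite: Washington1997, §13.1 (proof of Thm. 13.4)] -/
theorem finite_setOf_idelicCharacter_localUnits_eq_one (hK : IsImaginaryQuadratic K)
    {v vbar : HeightOneSpectrum (𝓞 K)} (hv : ((p : ℕ) : 𝓞 K) ∈ v.asIdeal)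
    (hvbar : ((p : ℕ) : 𝓞 K) ∈ vbar.asIdeal) (hne : vbar ≠ v) (κ : ZpExtension K p)
    (hκ : κ.IsUnramifiedOutside v) {Λκ : ideleGroup K →ₜ* Multiplicative ℤ_[p]}
    (hΛκ : ∀ (a : ideleGroup K) (γ : absoluteGaloisGroup K),
      absGaloisAbProj K γ = ideleArtinMap K a → Λκ a = κ.toContinuousMonoidHom γ) :
    Set.Finite {u : (v.adicCompletionIntegers K)ˣ |
      Λκ (localUnits v (Units.map ((v.adicCompletionIntegers K).subtype : _ →* _) u)) = 1} := by
  haveI : IsTotallyComplex K := hK.2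
  let ψ : (v.adicCompletionIntegers K)ˣ →ₜ* Multiplicative ℤ_[p] :=
    ⟨Λκ.toMonoidHom.comp ((localUnits v).comp (Units.map ((v.adicCompletionIntegers K).subtype :
        v.adicCompletionIntegers K →* v.adicCompletion K))),
      Λκ.continuous.comp (IdelicCharacter.continuous_localUnits_unitsMap v)⟩
  have hψ : ψ ≠ 1 := by
    intro h
    obtain ⟨w, hw, y, hne'⟩ := ZpExtension.exists_idelicCharacter_localUnits_ne_one κ hΛκ
    by_cases hwv : w = v
    · subst hwv
      exact hne' (DFunLike.congr_fun h y)
    · exact hne' (ZpExtension.idelicCharacter_unitsMap_eq_one_of_isUnramifiedOutside κ hΛκ hκ hwv y)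
  exact finite_setOf_apply_eq_one_of_natCard_quot_eq hv
    (natCard_quot_adicCompletionIntegers_eq_of_split hK.1 hv hvbar hne) ψ hψ

/-- The finite-idele part of an idele (`Units.map` of the second projection; private plumbing). [folklore] -/
private theorem mem_unitIdeles_of_forall_unitOrd_eq_zero {x : ideleGroup K} {k : Kˣ}
    (h : ∀ w : HeightOneSpectrum (𝓞 K), Literature.NumberTheory.Automorphic.FiniteAdeleRing.unitOrd (𝓞 K) K
      ((Units.map (RingHom.snd (InfiniteAdeleRing K) (FiniteAdeleRing (𝓞 K) K)).toMonoidHom :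
          ideleGroup K →* (FiniteAdeleRing (𝓞 K) K)ˣ) x *
        (IsDedekindDomain.FiniteAdeleRing.unitEmbedding (𝓞 K) K k)⁻¹) w = 0) :
    x * (principalIdele K k)⁻¹ ∈ unitIdeles K := by
  set sndU : ideleGroup K →* (FiniteAdeleRing (𝓞 K) K)ˣ :=
    Units.map (RingHom.snd (InfiniteAdeleRing K) (FiniteAdeleRing (𝓞 K) K)).toMonoidHom with hsndU
  intro w
  have h1 := (Literature.NumberTheory.Automorphic.FiniteAdeleRing.unitOrd_eq_zero_iff _ w).1 (h w)
  have h2 : sndU (x * (principalIdele K k)⁻¹) =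
      sndU x * (IsDedekindDomain.FiniteAdeleRing.unitEmbedding (𝓞 K) K k)⁻¹ := by
    rw [map_mul, map_inv, hsndU, ← unitsMap_snd_principalIdele]
    rfl
  rw [← h2] at h1
  exact h1

/-- **THE COUNT.** `K` imaginary quadratic, `p = v v̄` split, `κ` the `ℤ_p`-line unramified outside `v` with idelic character
`Λ_κ`. There are a finite set `E ⊆ ker Λ_κ` of ideles and `N ≥ 1` such that for every continuous idele character `Ψ` into
the Hausdorff abelian group `M` killing `Kˣ`, `K_∞ˣ` and the local units at every `w ≠ v`: (i) `Ψ(e)^N = 1` for `e ∈ E`,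
and (ii) every `x ∈ ker Λ_κ` has `Ψ(x) = Ψ(e)` for some `e ∈ E`. (Class-group reduction `x = k · x_t · u` over finitely many
representatives `x_t`, `FiniteAdeleRing.exists_finset_forall_exists_unitOrd_eq_zero`; the unit idele `u` is seen only through
`u_v ∈ 𝒪_vˣ`, which lies in the finite `F_v` as `Λ_κ(x) = Λ_κ(x_t) = 1`; `N = h_K · #F_v` from `x^{h_K} = k · u`.) This is
«`Gal(M_v(K)/K_∞)` is finite» for the maximal abelian extension `M_v(K)` unramified outside `v` (Lang's
`Gal(M/K) ∼ U_p/Ē ∼ ℤ_p^{[K:ℚ]}` cut down by `𝒪_{v̄}ˣ` and the line). [cite: Lang1990, Ch. 5 §5, Thm. 5.1]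
[cite: Washington1997, §13.1 (proof of Thm. 13.4)] [cite: CasselsFrohlichANT1967, Ch. II §17 Theorem] -/
theorem exists_finset_reduction (hK : IsImaginaryQuadratic K)
    {v vbar : HeightOneSpectrum (𝓞 K)} (hv : ((p : ℕ) : 𝓞 K) ∈ v.asIdeal)
    (hvbar : ((p : ℕ) : 𝓞 K) ∈ vbar.asIdeal) (hne : vbar ≠ v) (κ : ZpExtension K p)
    (hκ : κ.IsUnramifiedOutside v) {Λκ : ideleGroup K →ₜ* Multiplicative ℤ_[p]}
    (hΛκ : ∀ (a : ideleGroup K) (γ : absoluteGaloisGroup K),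
      absGaloisAbProj K γ = ideleArtinMap K a → Λκ a = κ.toContinuousMonoidHom γ)
    (M : Type*) [CommGroup M] [TopologicalSpace M] [T2Space M] :
    ∃ (E : Finset (ideleGroup K)) (N : ℕ), 0 < N ∧ (∀ e ∈ E, Λκ e = 1) ∧
      (∀ Ψ : ideleGroup K →ₜ* M,
        (∀ x ∈ principalIdeles K, Ψ x = 1) → (∀ y : (InfiniteAdeleRing K)ˣ, Ψ (infiniteIdeles K y) = 1) →
        (∀ w : HeightOneSpectrum (𝓞 K), w ≠ v → ∀ u : (w.adicCompletionIntegers K)ˣ,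
          Ψ (localUnits w (Units.map ((w.adicCompletionIntegers K).subtype : _ →* _) u)) = 1) →
        ∀ e ∈ E, Ψ e ^ N = 1) ∧
      ∀ x : ideleGroup K, Λκ x = 1 → ∃ e ∈ E, ∀ Ψ : ideleGroup K →ₜ* M,
        (∀ x ∈ principalIdeles K, Ψ x = 1) → (∀ y : (InfiniteAdeleRing K)ˣ, Ψ (infiniteIdeles K y) = 1) →
        (∀ w : HeightOneSpectrum (𝓞 K), w ≠ v → ∀ u : (w.adicCompletionIntegers K)ˣ,
          Ψ (localUnits w (Units.map ((w.adicCompletionIntegers K).subtype : _ →* _) u)) = 1) →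
        Ψ x = Ψ e := by
  classical
  haveI : IsTotallyComplex K := hK.2
  -- admissibility of `Λκ` itself
  have hΛP : ∀ x ∈ principalIdeles K, Λκ x = 1 := fun x hx ↦
    ZpExtension.idelicCharacter_eq_one_of_mem_principalIdeles hΛκ hx
  have hΛI : ∀ y : (InfiniteAdeleRing K)ˣ, Λκ (infiniteIdeles K y) = 1 := fun y ↦
    ZpExtension.idelicCharacter_infiniteIdeles hΛκ y
  have hΛU : ∀ w : HeightOneSpectrum (𝓞 K), w ≠ v → ∀ u : (w.adicCompletionIntegers K)ˣ,
      Λκ (localUnits w (Units.map ((w.adicCompletionIntegers K).subtype : _ →* _) u)) = 1 :=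
    fun w hw u ↦ ZpExtension.idelicCharacter_unitsMap_eq_one_of_isUnramifiedOutside κ hΛκ hκ hw u
  -- the finite subgroup `F_v`
  have hF := finite_setOf_idelicCharacter_localUnits_eq_one hK hv hvbar hne κ hκ hΛκ
  let Fsub : Subgroup (v.adicCompletionIntegers K)ˣ :=
    (Λκ.toMonoidHom.comp ((localUnits v).comp (Units.map ((v.adicCompletionIntegers K).subtype :
        v.adicCompletionIntegers K →* v.adicCompletion K)))).ker
  have hFsub : ∀ u : (v.adicCompletionIntegers K)ˣ, u ∈ Fsub ↔
      Λκ (localUnits v (Units.map ((v.adicCompletionIntegers K).subtype : _ →* _) u)) = 1 := fun u ↦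
    MonoidHom.mem_ker
  haveI hFfin : Finite Fsub := by
    refine Set.finite_coe_iff.mpr (hF.subset ?_)
    intro u hu
    exact (hFsub u).mp hu
  set f : ℕ := Nat.card Fsub with hf
  have hf0 : 0 < f := Nat.card_pos
  have hFpow : ∀ u : (v.adicCompletionIntegers K)ˣ, u ∈ Fsub → u ^ f = 1 := fun u hu ↦ by
    have h := orderOf_dvd_natCard (⟨u, hu⟩ : Fsub)
    rw [← hf, orderOf_dvd_iff_pow_eq_one] at h
    exact congrArg Subtype.val h
  -- the class number step
  set h : ℕ := Fintype.card (ClassGroup (𝓞 K)) with hh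
  have hh0 : 0 < h := Fintype.card_pos
  let sndU : ideleGroup K →* (FiniteAdeleRing (𝓞 K) K)ˣ :=
    Units.map (RingHom.snd (InfiniteAdeleRing K) (FiniteAdeleRing (𝓞 K) K)).toMonoidHom
  have hdec : ∀ x : ideleGroup K, ∃ k : Kˣ, x ^ h * (principalIdele K k)⁻¹ ∈ unitIdeles K := by
    intro x
    obtain ⟨k, hk⟩ :=
      FiniteAdeleRing.exists_unitOrd_pow_card_classGroup_eq_zero (F := K) (sndU x)
    refine ⟨k, mem_unitIdeles_of_forall_unitOrd_eq_zero fun w ↦ ?_⟩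
    have := hk w
    rwa [← map_pow] at this
  -- representatives of the ideal classes
  obtain ⟨T, hT⟩ := Literature.NumberTheory.Automorphic.FiniteAdeleRing.exists_finset_forall_exists_unitOrd_eq_zero
    (R := 𝓞 K) (K := K)
  let R : ideleGroup K → (FiniteAdeleRing (𝓞 K) K)ˣ → Prop := fun x t ↦ ∃ k : Kˣ, ∀ w,
    Literature.NumberTheory.Automorphic.FiniteAdeleRing.unitOrd (𝓞 K) K
      (sndU x * t⁻¹ * (IsDedekindDomain.FiniteAdeleRing.unitEmbedding (𝓞 K) K k)⁻¹) w = 0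
  have hRall : ∀ x : ideleGroup K, ∃ t ∈ T, R x t := fun x ↦ hT (sndU x)
  -- two ideles in the same class differ by a principal idele times a unit idele
  have hRR : ∀ {x x' : ideleGroup K} {t : (FiniteAdeleRing (𝓞 K) K)ˣ}, R x t → R x' t →
      ∃ k : Kˣ, x * x'⁻¹ * (principalIdele K k)⁻¹ ∈ unitIdeles K := by
    rintro x x' t ⟨k, hk⟩ ⟨k', hk'⟩
    refine ⟨k * k'⁻¹, mem_unitIdeles_of_forall_unitOrd_eq_zero fun w ↦ ?_⟩
    have e1 := hk w
    have e2 := hk' w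
    have heq : sndU (x * x'⁻¹) * (IsDedekindDomain.FiniteAdeleRing.unitEmbedding (𝓞 K) K (k * k'⁻¹))⁻¹ =
        (sndU x * t⁻¹ * (IsDedekindDomain.FiniteAdeleRing.unitEmbedding (𝓞 K) K k)⁻¹) *
          (sndU x' * t⁻¹ * (IsDedekindDomain.FiniteAdeleRing.unitEmbedding (𝓞 K) K k')⁻¹)⁻¹ := by
      simp only [map_mul, map_inv, mul_inv_rev, inv_inv]
      simp only [mul_comm, mul_left_comm, mul_assoc, mul_inv_cancel_left]
    show Literature.NumberTheory.Automorphic.FiniteAdeleRing.unitOrd (𝓞 K) K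
      (sndU (x * x'⁻¹) * (IsDedekindDomain.FiniteAdeleRing.unitEmbedding (𝓞 K) K (k * k'⁻¹))⁻¹) w = 0
    rw [heq, Literature.NumberTheory.Automorphic.FiniteAdeleRing.unitOrd_mul,
      Literature.NumberTheory.Automorphic.FiniteAdeleRing.unitOrd_inv, e1, e2, neg_zero, add_zero]
  -- chosen representatives in `ker Λκ`
  let rep : (FiniteAdeleRing (𝓞 K) K)ˣ → ideleGroup K := fun t ↦
    if hx : ∃ x : ideleGroup K, Λκ x = 1 ∧ R x t then hx.choose else 1
  have hrep1 : ∀ t, Λκ (rep t) = 1 := fun t ↦ by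
    by_cases hx : ∃ x : ideleGroup K, Λκ x = 1 ∧ R x t
    · simp only [rep, dif_pos hx]; exact hx.choose_spec.1
    · simp only [rep, dif_neg hx, map_one]
  have hrepR : ∀ t (x : ideleGroup K), Λκ x = 1 → R x t → R (rep t) t := fun t x hx hxt ↦ by
    have hex : ∃ x : ideleGroup K, Λκ x = 1 ∧ R x t := ⟨x, hx, hxt⟩
    simp only [rep, dif_pos hex]
    exact hex.choose_spec.2
  -- the finite set `E = {x_t · ⟨u⟩_v : t ∈ T, u ∈ F_v}` and `N = h · f`
  let locv : (v.adicCompletionIntegers K)ˣ → ideleGroup K := fun u ↦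
    localUnits v (Units.map ((v.adicCompletionIntegers K).subtype : _ →* _) u)
  let Fset : Finset (v.adicCompletionIntegers K)ˣ := hF.toFinset
  refine ⟨(T ×ˢ Fset).image (fun tu ↦ rep tu.1 * locv tu.2), h * f, Nat.mul_pos hh0 hf0, ?_, ?_⟩
  · intro e he
    obtain ⟨⟨t, u⟩, htu, rfl⟩ := Finset.mem_image.mp he
    have hu : Λκ (locv u) = 1 := by
      have := (Finset.mem_product.mp htu).2
      exact (Set.Finite.mem_toFinset hF).mp this
    change Λκ (rep t * locv u) = 1
    rw [map_mul, hrep1, hu, one_mul]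
  have hredΛ : ∀ {y : ideleGroup K} (hy : y ∈ unitIdeles K),
      Λκ y = Λκ (locv (unitIdeles.localUnit v ⟨y, hy⟩)) := fun hy ↦
    apply_eq_apply_localUnits_of_mem_unitIdeles Λκ v hΛI hΛU hy
  -- exponent: `Ψ(x)^{h f} = 1` on `ker Λκ` for every admissible `Ψ`
  have hexp : ∀ Ψ : ideleGroup K →ₜ* M,
      (∀ x ∈ principalIdeles K, Ψ x = 1) → (∀ y : (InfiniteAdeleRing K)ˣ, Ψ (infiniteIdeles K y) = 1) →
      (∀ w : HeightOneSpectrum (𝓞 K), w ≠ v → ∀ u : (w.adicCompletionIntegers K)ˣ,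
        Ψ (localUnits w (Units.map ((w.adicCompletionIntegers K).subtype : _ →* _) u)) = 1) →
      ∀ x : ideleGroup K, Λκ x = 1 → Ψ x ^ (h * f) = 1 := by
    intro Ψ hP hI hU x hx
    obtain ⟨k, hk⟩ := hdec x
    set y := x ^ h * (principalIdele K k)⁻¹ with hy
    have hΨy : Ψ y = Ψ x ^ h := by
      rw [hy, map_mul, map_inv, hP _ (principalIdele_mem k), inv_one, mul_one, map_pow]
    have hΛy : Λκ y = 1 := by
      rw [hy, map_mul, map_inv, hΛP _ (principalIdele_mem k), inv_one, mul_one, map_pow, hx, one_pow]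
    have huF : unitIdeles.localUnit v ⟨y, hk⟩ ∈ Fsub := by
      rw [hFsub, ← hredΛ hk (y := y)]; exact hΛy
    rw [pow_mul, ← hΨy, apply_eq_apply_localUnits_of_mem_unitIdeles Ψ v hI hU hk, ← map_pow, ← map_pow,
      ← map_pow, hFpow _ huF, map_one, map_one, map_one]
  refine ⟨fun Ψ hP hI hU e he ↦ ?_, fun x hx ↦ ?_⟩
  · obtain ⟨⟨t, u⟩, htu, rfl⟩ := Finset.mem_image.mp he
    have hu : Λκ (locv u) = 1 := by
      have := (Finset.mem_product.mp htu).2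
      exact (Set.Finite.mem_toFinset hF).mp this
    refine hexp Ψ hP hI hU _ ?_
    change Λκ (rep t * locv u) = 1
    rw [map_mul, hrep1, hu, one_mul]
  · obtain ⟨t, htT, hxt⟩ := hRall x
    have hxt' : R (rep t) t := hrepR t x hx hxt
    obtain ⟨k, hk⟩ := hRR hxt hxt'
    set y := x * (rep t)⁻¹ * (principalIdele K k)⁻¹ with hy
    have hΛy : Λκ y = 1 := by
      rw [hy, map_mul, map_inv, hΛP _ (principalIdele_mem k), inv_one, mul_one, map_mul, map_inv, hx,
        hrep1, inv_one, mul_one]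
    set u := unitIdeles.localUnit v ⟨y, hk⟩ with hu
    have huF : Λκ (locv u) = 1 := by rw [hu, ← hredΛ hk (y := y)]; exact hΛy
    refine ⟨rep t * locv u, Finset.mem_image.mpr ⟨(t, u), Finset.mem_product.mpr ⟨htT, ?_⟩, rfl⟩, ?_⟩
    · exact (Set.Finite.mem_toFinset hF).mpr huF
    · intro Ψ hP hI hU
      have hΨy : Ψ y = Ψ x * (Ψ (rep t))⁻¹ := by
        rw [hy, map_mul, map_inv, hP _ (principalIdele_mem k), inv_one, mul_one, map_mul, map_inv]
      rw [map_mul, hu, ← apply_eq_apply_localUnits_of_mem_unitIdeles Ψ v hI hU hk, hΨy, mul_comm (Ψ x) _,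
        ← mul_assoc, mul_inv_cancel, one_mul]

/-! ## §6 Back to Galois: the restrictions to `Gal(K̄/K_∞)` of the characters unramified outside `v` -/

/-- **THE ARITHMETIC LEMMA.** `K` imaginary quadratic, `p = v v̄` split (any prime `p`), `κ` the `ℤ_p`-extension of `K`
unramified outside `v` (`K_∞ = K̄^{ker κ}`), `B` a DISCRETE abelian group with finite `N`-torsion for every `N ≥ 1`
(e.g. `ℚ_p/ℤ_p`). Then the RESTRICTIONS TO `Gal(K̄/K_∞)` of the continuous characters `χ : Γ_K → B` unramified outside
`v` (killing the inertia groups `I_w`, `w ≠ v`) form a FINITE set — although the characters themselves do not (they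
contain the line `ℚ_p/ℤ_p` of characters of `Gal(K_∞/K) ≅ ℤ_p`). Class field theory: `χ ↦ Λ_χ|_{ker Λ_κ}` is faithful on
restrictions (`[·, K]` is onto, `exists_ideleArtinMap_eq`), and by `exists_finset_reduction` the latter is a function on a
fixed finite set `E` with values in the finite `B[N]`. Equivalently: `[M_v(K) : K_∞] < ∞` for the maximal abelian
extension `M_v(K)` of `K` unramified outside `v` — Lang's `Gal(M/K) ∼ U_p/Ē ∼ ℤ_p^{[K:ℚ]}` (Thm. 5.1) cut down by `𝒪_{v̄}ˣ`.
[cite: Lang1990, Ch. 5 §5, Thm. 5.1] [cite: Washington1997, §13.1 (proof of Thm. 13.4)] [cite: Greenberg1978, §4] -/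
theorem finite_setOf_restrict_kerSubgroup (hK : IsImaginaryQuadratic K)
    {v vbar : HeightOneSpectrum (𝓞 K)} (hv : ((p : ℕ) : 𝓞 K) ∈ v.asIdeal)
    (hvbar : ((p : ℕ) : 𝓞 K) ∈ vbar.asIdeal) (hne : vbar ≠ v) (κ : ZpExtension K p)
    (hκ : κ.IsUnramifiedOutside v)
    {B : Type*} [CommGroup B] [TopologicalSpace B] [DiscreteTopology B]
    (hB : ∀ N : ℕ, 0 < N → Set.Finite {b : B | b ^ N = 1}) :
    Set.Finite {f : κ.kerSubgroup → B | ∃ χ : absoluteGaloisGroup K →ₜ* B,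
      (∀ w : HeightOneSpectrum (𝓞 K), w ≠ v → GreenbergSelmer.inertia w ≤ (χ : absoluteGaloisGroup K →* B).ker) ∧
      f = fun g : κ.kerSubgroup ↦ χ (g : absoluteGaloisGroup K)} := by
  classical
  haveI : IsTotallyComplex K := hK.2
  obtain ⟨Λκ, hΛκ⟩ := ZpExtension.exists_idelicCharacter κ.toContinuousMonoidHom
  obtain ⟨E, N, hN, -, hEN, hred⟩ := exists_finset_reduction hK hv hvbar hne κ hκ hΛκ B
  -- admissibility of the avatar of an unramified-outside-`v` character
  have hadm : ∀ (χ : absoluteGaloisGroup K →ₜ* B) (Λ : ideleGroup K →ₜ* B),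
      (∀ w : HeightOneSpectrum (𝓞 K), w ≠ v → GreenbergSelmer.inertia w ≤ (χ : absoluteGaloisGroup K →* B).ker) →
      (∀ (a : ideleGroup K) (γ : absoluteGaloisGroup K), absGaloisAbProj K γ = ideleArtinMap K a → Λ a = χ γ) →
      (∀ x ∈ principalIdeles K, Λ x = 1) ∧ (∀ y : (InfiniteAdeleRing K)ˣ, Λ (infiniteIdeles K y) = 1) ∧
      (∀ w : HeightOneSpectrum (𝓞 K), w ≠ v → ∀ u : (w.adicCompletionIntegers K)ˣ,
        Λ (localUnits w (Units.map ((w.adicCompletionIntegers K).subtype : _ →* _) u)) = 1) := by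
    intro χ Λ hχ hΛ
    have hopen : IsOpen (((χ : absoluteGaloisGroup K →* B).ker : Subgroup (absoluteGaloisGroup K)) :
        Set (absoluteGaloisGroup K)) := by
      have : ((χ : absoluteGaloisGroup K →* B).ker : Set (absoluteGaloisGroup K)) = χ ⁻¹' {1} := by
        ext g; exact MonoidHom.mem_ker
      rw [this]
      exact (isOpen_discrete ({1} : Set B)).preimage χ.continuous
    exact ⟨fun x hx ↦ by rw [hΛ x 1 (by rw [map_one, ideleArtinMap_eq_one_of_mem_principalIdeles hx]), map_one],
      fun y ↦ by rw [hΛ _ 1 (by rw [map_one, ideleArtinMap_infiniteIdeles y]), map_one],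
      fun w hw u ↦ idelicCharacter_localUnits_eq_one_of_ne hΛ hopen hχ hw u⟩
  -- the set and the comparison map `f ↦ (e ↦ Λ_{χ_f} e)`
  set S : Set (κ.kerSubgroup → B) := {f | ∃ χ : absoluteGaloisGroup K →ₜ* B,
      (∀ w : HeightOneSpectrum (𝓞 K), w ≠ v → GreenbergSelmer.inertia w ≤ (χ : absoluteGaloisGroup K →* B).ker) ∧
      f = fun g : κ.kerSubgroup ↦ χ (g : absoluteGaloisGroup K)} with hS
  -- choices
  have hχex : ∀ f : S, ∃ χ : absoluteGaloisGroup K →ₜ* B,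
      (∀ w : HeightOneSpectrum (𝓞 K), w ≠ v → GreenbergSelmer.inertia w ≤ (χ : absoluteGaloisGroup K →* B).ker) ∧
      (f : κ.kerSubgroup → B) = fun g : κ.kerSubgroup ↦ χ (g : absoluteGaloisGroup K) := fun f ↦ f.2
  choose χ hχ hfχ using hχex
  have hΛex : ∀ f : S, ∃ Λ : ideleGroup K →ₜ* B, ∀ (a : ideleGroup K) (γ : absoluteGaloisGroup K),
      absGaloisAbProj K γ = ideleArtinMap K a → Λ a = χ f γ := fun f ↦ exists_idelicCharacter (χ f)
  choose Λ hΛ using hΛex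
  let G : S → (↥E → B) := fun f e ↦ Λ f e.1
  -- `G` takes values in the finite set of functions `E → B[N]`
  have hfinT : Set.Finite (Set.univ.pi fun _ : ↥E ↦ {b : B | b ^ N = 1}) :=
    Set.Finite.pi fun _ ↦ hB N hN
  have hGmem : ∀ f : S, G f ∈ Set.univ.pi fun _ : ↥E ↦ {b : B | b ^ N = 1} := by
    intro f e _
    obtain ⟨hP, hI, hU⟩ := hadm (χ f) (Λ f) (hχ f) (hΛ f)
    exact hEN (Λ f) hP hI hU e.1 e.2
  -- `G` is injective
  have hGinj : Function.Injective G := by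
    intro f₁ f₂ h12
    apply Subtype.ext
    rw [hfχ f₁, hfχ f₂]
    funext g
    obtain ⟨a, ha⟩ := exists_ideleArtinMap_eq (K := K) (g : absoluteGaloisGroup K)
    have hκa : Λκ a = 1 := by
      rw [hΛκ a g ha.symm]
      change κ (g : absoluteGaloisGroup K) = 1
      exact (ZpExtension.mem_kerSubgroup).mp g.2
    obtain ⟨e, heE, he⟩ := hred a hκa
    obtain ⟨hP₁, hI₁, hU₁⟩ := hadm (χ f₁) (Λ f₁) (hχ f₁) (hΛ f₁)
    obtain ⟨hP₂, hI₂, hU₂⟩ := hadm (χ f₂) (Λ f₂) (hχ f₂) (hΛ f₂)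
    have h1 : Λ f₁ a = Λ f₁ e := he (Λ f₁) hP₁ hI₁ hU₁
    have h2 : Λ f₂ a = Λ f₂ e := he (Λ f₂) hP₂ hI₂ hU₂
    have h3 : G f₁ ⟨e, heE⟩ = G f₂ ⟨e, heE⟩ := by rw [h12]
    change Λ f₁ e = Λ f₂ e at h3
    rw [← hΛ f₁ a g ha.symm, ← hΛ f₂ a g ha.symm, h1, h2, h3]
  -- conclude
  have hSfin : (Set.univ : Set S).Finite :=
    Set.Finite.of_finite_image (hfinT.subset (by rintro _ ⟨f, -, rfl⟩; exact hGmem f)) hGinj.injOn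
  exact Set.finite_coe_iff.mp (Set.finite_univ_iff.mp hSfin)

end Count

end Summit.BirchSwinnertonDyer.BirchSwinnertonDyer.Theorems.TwoAdicBDPSplitPrimeTorsion

end
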